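import Summits.MatrixMultiplication.MatrixMultiplication.Theorems.AbelianSTPPCensusTAStatKMemberXSplit

/-!
# Static t*-certificate: assembling one shape check of the multi-parameter k-member tree from separately checked buckets and orders (data-free)

Cell mm-stpp (rung F-M1).  `AbelianSTPPCensusTAStatKMemberXSplit.lean` (vp-p2 gen 6) splits ONE node of the tree `TAStatKM.treeKX` / `rootKX` into
separately compiled `goIR` pieces.  A range's shape check (`checkShape`, one `decide` per (volume, order sub-range) so far) reaches such a node
through the bucket walk `TAStatKM.walk4` and the order cover `TAStatKM.coverKX`; this file adds the bookkeeping that lets a generator assemble the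
walk itself from per-bucket facts — `walk4_nil_eq`, `walk4_cons_of_or` (the bucket passes by the one-member `cover` or by the tree cover, checked as one
Bool), `walk4_cons_of_coverKX` (the bucket's tree cover supplied as a separately assembled fact), `walk4_cons_of_tiOK` (escape) — and the order
cover from single orders (`coverKX_single`; several orders: `coverKX_append` of the Split file).  Used by the T_B range `5995 …` (PRE-REG v1 band B1,
vp-p2 gen 7), where single (cell, order) trees exceed one `decide`.
No soundness content: equalities between Bool computations; `walk4_sound` / `rootKX_sound` apply to the assembled facts exactly as before.
WHAT THIS IS NOT: no statement about STPP families, orders or `ω`.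
-/

set_option linter.dupNamespace false
set_option autoImplicit false

namespace Summit.MatrixMultiplication.MatrixMultiplication.Theorems.TAStatKM

open TAStat (Entry cover)
open TAStat2M (tiOK)

section Walk

variable (tb : ℕ → ℕ) (m2 : ℕ → List (ℕ × ℕ × ℕ)) (gain : ℕ → ℕ) (row : ℕ → Entry) (xrow : ℕ → List (ℕ × ℕ × ℕ)) (tp : ℕ → ℕ)

/-- the walk over an exhausted row passes [bookkeeping] -/
theorem walk4_nil_eq (g p V d al tl kmax L H j0 j : ℕ) :
    walk4 tb m2 gain row xrow tp g p V d al tl kmax L H j0 [] j = true := rfl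

/-- one step of the walk, unfolded [bookkeeping] -/
theorem walk4_cons_eq (g p V d al tl kmax L H j0 j : ℕ) (e : Entry) (es : List Entry) :
    walk4 tb m2 gain row xrow tp g p V d al tl kmax L H j0 (e :: es) j =
      (tiOK V (tb j) || ((cover g p V d (tp j) L H e || coverKX tb m2 gain row xrow g p V d al tl kmax j j0 L H) &&
        walk4 tb m2 gain row xrow tp g p V d al tl kmax L H j0 es (j + 1))) := rfl

variable {tb m2 gain row xrow tp}

/-- **A bucket from its parts, generic form**: the bucket passes by the one-member cover or by the tree cover (one Bool, e.g. by `decide`), and the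
rest of the walk passes. [bookkeeping] -/
theorem walk4_cons_of_or {g p V d al tl kmax L H j0 j : ℕ} {e : Entry} {es : List Entry}
    (hc : (cover g p V d (tp j) L H e || coverKX tb m2 gain row xrow g p V d al tl kmax j j0 L H) = true)
    (hw : walk4 tb m2 gain row xrow tp g p V d al tl kmax L H j0 es (j + 1) = true) :
    walk4 tb m2 gain row xrow tp g p V d al tl kmax L H j0 (e :: es) j = true := by
  rw [walk4_cons_eq, hc, hw]; simp

/-- **A bucket from its parts, tree form**: the bucket's tree cover (assembled separately, e.g. from `rootKX_of_parts` per order) and the rest of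
the walk give the walk. [bookkeeping] -/
theorem walk4_cons_of_coverKX {g p V d al tl kmax L H j0 j : ℕ} {e : Entry} {es : List Entry}
    (hc : coverKX tb m2 gain row xrow g p V d al tl kmax j j0 L H = true)
    (hw : walk4 tb m2 gain row xrow tp g p V d al tl kmax L H j0 es (j + 1) = true) :
    walk4 tb m2 gain row xrow tp g p V d al tl kmax L H j0 (e :: es) j = true := by
  rw [walk4_cons_eq, hc, hw]; simp

/-- a bucket at which the walk escapes (`tiOK`) [bookkeeping] -/
theorem walk4_cons_of_tiOK {g p V d al tl kmax L H j0 j : ℕ} {e : Entry} {es : List Entry} (h : tiOK V (tb j) = true) :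
    walk4 tb m2 gain row xrow tp g p V d al tl kmax L H j0 (e :: es) j = true := by
  rw [walk4_cons_eq, h]; simp

/-- the tree cover of a single order from the root fact at that order [bookkeeping] -/
theorem coverKX_single {g p V d al tl kmax j j0 M : ℕ} (h : rootKX tb m2 gain row xrow g p V d al tl M kmax j j0 = true) :
    coverKX tb m2 gain row xrow g p V d al tl kmax j j0 M M = true := by
  simp only [coverKX, List.all_eq_true, List.mem_range]
  intro k hk
  have hk0 : k = 0 := by omega
  subst hk0
  simpa using h

end Walk

end Summit.MatrixMultiplication.MatrixMultiplication.Theorems.TAStatKM
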